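import Literature.NumberTheory.Transcendental.FormIntegrationAddProofs
import HarnessLib

/-!
# Independence of the partition of unity (`MForm.integralPU_eq_integral` discharged)

Topic: integration of top-degree differential forms on compact oriented manifolds. This file
discharges the named fact `Literature.Geometry.Kaehler.MForm.integralPU_eq_integral` of
`Literature/NumberTheory/Transcendental/FormIntegration.lean`: on a compact manifold `M`
(boundary and corners allowed) with a continuous orientation family `o`, the integral of a
smooth top form computed with *any* smooth partition of unity `ρ` subordinate to the sources of
the charts centred at `c i` equals `∫_M α` (which is computed with the chosen partition of unity
`chartPartitionOfUnity I M`). Warner (1983), 4.8, eqs. (2)–(4) (PDF p. 132–133: "we must check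
that the definition (1) is independent of the cover and the partition of unity chosen");
Lee (2013), Prop. 16.4–16.5 (PDF pp. 438–439). Everything is proved; no `Boundaryless`
hypothesis is used (all the analysis happens on the chart targets, within `range I`).

## Main statements (all proved)

* `Literature.NumberTheory.Transcendental.setIntegral_chartIntegrand_eq_of_support_subset`: the
  chart integral `∫ chartSign o p · (f ∘ chart⁻¹) · α̂_p(e₁, …, eₙ) dλ` of `f • α` does not
  depend on the chart `p`, as long as `f` is supported in the chart source (Lee (2013),
  Prop. 16.4, in pointwise-sign form: the chart sign times the Jacobian determinant of the
  transition map is its absolute value, so Mathlib's change of variables formula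
  `integral_image_eq_integral_abs_det_fderiv_smul` applies on the overlap). No smoothness,
  continuity or orientability hypothesis is needed for this step.
* `Literature.NumberTheory.Transcendental.integrableOn_chartIntegrand_of_tsupport_subset`: the
  chart integrands are integrable (continuous on the target, vanishing off a compact set); this
  is where `IsContinuousOrientation o` and `IsSmoothForm α` enter.
* `Literature.NumberTheory.Transcendental.integralPU_eq_sum_sum`: insertion of a second partition
  of unity `ψ`, `∑ᵢ ∫ ρᵢ α = ∑ᵢ ∑ⱼ ∫ ρᵢ ψⱼ α` (Warner (1983), 4.8 (2)–(3); finite sums on a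
  compact manifold).
* `Literature.Geometry.Kaehler.MForm.integralPU_eq_integral_holds : MForm.integralPU_eq_integral o`.

## Proof architecture (Warner (1983), 4.8 (2)–(4); Lee (2013), Prop. 16.5)

With `ψ = chartPartitionOfUnity I M`:
`∑ᵢ ∫_{chart cᵢ} ρᵢ α = ∑ᵢ ∑ⱼ ∫_{chart cᵢ} ρᵢ ψⱼ α` (as `∑ⱼ ψⱼ = 1`, `integralPU_eq_sum_sum`)
`= ∑ᵢ ∑ⱼ ∫_{chart j} ρᵢ ψⱼ α` (`setIntegral_chartIntegrand_eq_of_support_subset`, the support of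
`ρᵢ ψⱼ` lying in both chart sources) `= ∑ⱼ ∫_{chart j} ψⱼ α = ∫_M α` (as `∑ᵢ ρᵢ = 1`).

## References

* F. W. Warner, *Foundations of Differentiable Manifolds and Lie Groups*, GTM 94, Springer
  (1983), 4.8 (integration on an oriented manifold; independence of cover and partition of
  unity, eqs. (1)–(4)).
* J. M. Lee, *Introduction to Smooth Manifolds*, 2nd ed., GTM 218, Springer (2013),
  Prop. 16.4–16.5 (PDF pp. 438–439).
-/

noncomputable section

open scoped Manifold ContDiff Topology
open Bundle Set Module MeasureTheory Function Filter
open Literature.Geometry.Kaehler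

namespace Literature.NumberTheory.Transcendental

/-! ### The overlap of two extended charts, read in the first chart -/

section Overlap

variable {E : Type*} [NormedAddCommGroup E] [NormedSpace ℝ E]
  {H : Type*} [TopologicalSpace H] {I : ModelWithCorners ℝ E H}
  {M : Type*} [TopologicalSpace M] [ChartedSpace H M]

/-- The part of the target of the extended chart at `p` mapped by the inverse chart into a set
`U ⊆ M` is the trace on `range I` of the preimage under `I.symm` of the corresponding subset of
the (model space `H`) chart target. [folklore] -/
theorem extChartAt_target_inter_preimage_eq (p : M) (U : Set M) :
    (extChartAt I p).target ∩ (extChartAt I p).symm ⁻¹' U =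
      I.symm ⁻¹' ((chartAt H p).target ∩ (chartAt H p).symm ⁻¹' U) ∩ range I := by
  rw [extChartAt_target, extChartAt_coe_symm]
  ext y
  simp only [mem_inter_iff, mem_preimage, Function.comp_apply]
  tauto

/-- For an open `U ⊆ M`, the part of the chart target at `p` mapped into `U` by the inverse
extended chart is Borel measurable (an open set cut down to the closed set `range I`; it is not
open in `E` when `M` has boundary). [folklore] -/
theorem measurableSet_extChartAt_target_inter_preimage [MeasurableSpace E]
    [OpensMeasurableSpace E] (p : M) {U : Set M} (hU : IsOpen U) :
    MeasurableSet ((extChartAt I p).target ∩ (extChartAt I p).symm ⁻¹' U) := by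
  rw [extChartAt_target_inter_preimage_eq]
  exact (((chartAt H p).continuousOn_symm.isOpen_inter_preimage (chartAt H p).open_target
    hU).preimage I.continuous_symm).measurableSet.inter I.isClosed_range.measurableSet

end Overlap

/-! ### Chart independence of the chart integrals (Lee (2013), Prop. 16.4) -/

section ChartChange

variable {E : Type*} [NormedAddCommGroup E] [NormedSpace ℝ E] [FiniteDimensional ℝ E]
  {n : ℕ} [Fact (finrank ℝ E = n)]
  {H : Type*} [TopologicalSpace H] {I : ModelWithCorners ℝ E H}
  {M : Type*} [TopologicalSpace M] [ChartedSpace H M] [IsManifold I ∞ M]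
  [MeasurableSpace E] [BorelSpace E]
  {o : (x : M) → Orientation ℝ (TangentSpace I x) (Fin n)}

variable (o) in
/-- **Chart independence of the chart integral of a form supported in a chart overlap**
(Lee (2013), Prop. 16.4, in pointwise-sign form; Warner (1983), 4.8 (4)). For a function `f` on
`M` vanishing off the intersection of the sources of the charts at `p` and `q`, a top form `α`
and an orientation family `o`,
`∫_{chart p} chartSign o p · (f ∘ chart⁻¹) · α̂_p(e) dλ = ∫_{chart q} chartSign o q · (f ∘ chart⁻¹) · α̂_q(e) dλ`:
both integrands vanish off the images of the overlap, the transition map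
`τ = extChartAt I q ∘ (extChartAt I p).symm` is an injective map between these images with
derivative `tangentCoordChange I p q` within the overlap (`hasFDerivWithinAt_tangentCoordChange`),
and at corresponding points `chartSign o p · α̂_p(e) = |det Dτ| · (chartSign o q · α̂_q(e)) ∘ τ`
(`chartSign_extChartAt_eq_sign_det_mul`, `MForm.inChart_extChartAt_eq_comp`, `sign d · d = |d|`),
so Mathlib's change of variables formula `integral_image_eq_integral_abs_det_fderiv_smul`
applies. No smoothness, continuity, measurability or orientability hypothesis is needed.
[cite: LeeSmoothManifolds2013, Prop. 16.4] -/
theorem setIntegral_chartIntegrand_eq_of_support_subset (α : MForm I M ℝ n) {f : M → ℝ}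
    {p q : M} (hf : ∀ x, f x ≠ 0 → x ∈ (extChartAt I p).source ∩ (extChartAt I q).source) :
    ∫ y in (extChartAt I p).target, chartSign o p y * f ((extChartAt I p).symm y) *
        α.inChart p y (modelBasis E n) ∂(modelBasis E n).addHaar =
      ∫ y in (extChartAt I q).target, chartSign o q y * f ((extChartAt I q).symm y) *
        α.inChart q y (modelBasis E n) ∂(modelBasis E n).addHaar := by
  set e := modelBasis E n with he
  set Op := (extChartAt I p).target ∩ (extChartAt I p).symm ⁻¹' (extChartAt I q).source with hOp
  set Oq := (extChartAt I q).target ∩ (extChartAt I q).symm ⁻¹' (extChartAt I p).source with hOq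
  set τ := extChartAt I q ∘ (extChartAt I p).symm with hτ
  have hOpm : MeasurableSet Op :=
    measurableSet_extChartAt_target_inter_preimage p (isOpen_extChartAt_source q)
  -- both integrands vanish off the overlap
  have hzp : ∀ y ∈ (extChartAt I p).target \ Op,
      chartSign o p y * f ((extChartAt I p).symm y) * α.inChart p y e = 0 := by
    intro y hy
    have h0 : f ((extChartAt I p).symm y) = 0 := by
      by_contra h
      exact hy.2 ⟨hy.1, (hf _ h).2⟩
    rw [h0, mul_zero, zero_mul]
  have hzq : ∀ y ∈ (extChartAt I q).target \ Oq,
      chartSign o q y * f ((extChartAt I q).symm y) * α.inChart q y e = 0 := by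
    intro y hy
    have h0 : f ((extChartAt I q).symm y) = 0 := by
      by_contra h
      exact hy.2 ⟨hy.1, (hf _ h).1⟩
    rw [h0, mul_zero, zero_mul]
  have hLp : ∫ y in (extChartAt I p).target, chartSign o p y * f ((extChartAt I p).symm y) *
      α.inChart p y e ∂e.addHaar = ∫ y in Op, chartSign o p y * f ((extChartAt I p).symm y) *
        α.inChart p y e ∂e.addHaar :=
    setIntegral_eq_of_subset_of_forall_sdiff_eq_zero (measurableSet_extChartAt_target p)
      inter_subset_left hzp
  have hLq : ∫ y in (extChartAt I q).target, chartSign o q y * f ((extChartAt I q).symm y) *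
      α.inChart q y e ∂e.addHaar = ∫ y in Oq, chartSign o q y * f ((extChartAt I q).symm y) *
        α.inChart q y e ∂e.addHaar :=
    setIntegral_eq_of_subset_of_forall_sdiff_eq_zero (measurableSet_extChartAt_target q)
      inter_subset_left hzq
  -- the transition map: derivative within the overlap, injectivity, image
  have hτdiff : ∀ y ∈ Op,
      HasFDerivWithinAt τ (tangentCoordChange I p q ((extChartAt I p).symm y)) Op y := by
    intro y hy
    have hx : (extChartAt I p).symm y ∈ (extChartAt I p).source ∩ (extChartAt I q).source :=
      ⟨(extChartAt I p).map_target hy.1, hy.2⟩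
    have h := hasFDerivWithinAt_tangentCoordChange (I := I) hx
    rw [(extChartAt I p).right_inv hy.1] at h
    exact h.mono (inter_subset_left.trans (extChartAt_target_subset_range p))
  have hτinj : InjOn τ Op := by
    intro y hy y' hy' h
    have h' : (extChartAt I p).symm y = (extChartAt I p).symm y' :=
      (extChartAt I q).injOn hy.2 hy'.2 h
    rw [← (extChartAt I p).right_inv hy.1, ← (extChartAt I p).right_inv hy'.1, h']
  have himage : τ '' Op = Oq := by
    apply Subset.antisymm
    · rintro _ ⟨y, hy, rfl⟩
      refine ⟨(extChartAt I q).map_source hy.2, ?_⟩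
      rw [mem_preimage, hτ, Function.comp_apply, (extChartAt I q).left_inv hy.2]
      exact (extChartAt I p).map_target hy.1
    · rintro z ⟨hz, hzp⟩
      refine ⟨extChartAt I p ((extChartAt I q).symm z), ⟨(extChartAt I p).map_source hzp, ?_⟩, ?_⟩
      · rw [mem_preimage, (extChartAt I p).left_inv hzp]
        exact (extChartAt I q).map_target hz
      · rw [hτ, Function.comp_apply, (extChartAt I p).left_inv hzp, (extChartAt I q).right_inv hz]
  -- the pointwise identity on the overlap
  have hon : ∀ y ∈ Op, chartSign o p y * f ((extChartAt I p).symm y) * α.inChart p y e =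
      |(tangentCoordChange I p q ((extChartAt I p).symm y)).det| •
        (chartSign o q (τ y) * f ((extChartAt I q).symm (τ y)) * α.inChart q (τ y) e) := by
    intro y hy
    set x := (extChartAt I p).symm y with hx
    have hxp : x ∈ (extChartAt I p).source := (extChartAt I p).map_target hy.1
    have hxq : x ∈ (extChartAt I q).source := hy.2
    have hyx : y = extChartAt I p x := ((extChartAt I p).right_inv hy.1).symm
    have hτy : τ y = extChartAt I q x := rfl
    have h1 : α.inChart p y e = LinearMap.det (tangentCoordChange I p q x : E →ₗ[ℝ] E) *
        α.inChart q (extChartAt I q x) e := by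
      rw [hyx, MForm.inChart_extChartAt_eq_comp α hxp hxq,
        ContinuousAlternatingMap.compContinuousLinearMap_apply]
      exact ContinuousAlternatingMap.apply_comp_eq_det_mul e _ _ _
    have h2 : chartSign o p y =
        Real.sign (LinearMap.det (tangentCoordChange I p q x : E →ₗ[ℝ] E)) *
          chartSign o q (extChartAt I q x) := by
      rw [hyx]
      exact chartSign_extChartAt_eq_sign_det_mul o hxp hxq
    rw [hτy, (extChartAt I q).left_inv hxq, h1, h2, smul_eq_mul, ContinuousLinearMap.det,
      ← real_sign_mul_self]
    ring
  rw [hLp, hLq, ← himage,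
    integral_image_eq_integral_abs_det_fderiv_smul e.addHaar hOpm hτdiff hτinj]
  exact setIntegral_congr_fun hOpm hon

/-! ### Integrability of the chart integrands and insertion of a second partition of unity -/

variable [CompactSpace M]

/-- **Integrability of the chart integrands** `chartSign o p · (f ∘ chart⁻¹) · α̂_p(e₁, …, eₙ)` on
the chart target at `p`, for a continuous orientation family `o`, a smooth top form `α` and a
continuous function `f` whose (compact) closed support lies in the chart source: the integrand
is continuous on the target (`IsContinuousOrientation.continuousOn_chartSign`,
`IsSmoothForm.continuousOn_inChart_apply_modelBasis`) and vanishes off the compact set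
`extChartAt I p '' tsupport f`. Lee (2013), Prop. 16.5 / eq. (16.2) (each term of the
defining sums is a genuine integral). [cite: LeeSmoothManifolds2013, Prop. 16.5] -/
theorem integrableOn_chartIntegrand_of_tsupport_subset (ho : IsContinuousOrientation o)
    {α : MForm I M ℝ n} (hα : IsSmoothForm α) {f : M → ℝ} (hfc : Continuous f) {p : M}
    (hf : tsupport f ⊆ (extChartAt I p).source) :
    IntegrableOn (fun y ↦ chartSign o p y * f ((extChartAt I p).symm y) *
        α.inChart p y (modelBasis E n)) (extChartAt I p).target (modelBasis E n).addHaar := by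
  set K := extChartAt I p '' tsupport f with hK
  have hKc : IsCompact K :=
    (isClosed_tsupport _).isCompact.image_of_continuousOn ((continuousOn_extChartAt p).mono hf)
  have hKt : K ⊆ (extChartAt I p).target := by
    rintro _ ⟨x, hx, rfl⟩
    exact (extChartAt I p).map_source (hf hx)
  have hcont : ContinuousOn (fun y ↦ chartSign o p y * f ((extChartAt I p).symm y) *
      α.inChart p y (modelBasis E n)) (extChartAt I p).target :=
    ((ho.continuousOn_chartSign p).mul
      (hfc.comp_continuousOn (continuousOn_extChartAt_symm p))).mul
      (hα.continuousOn_inChart_apply_modelBasis p)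
  refine ((hcont.mono hKt).integrableOn_compact hKc).of_forall_sdiff_eq_zero
    (measurableSet_extChartAt_target p) fun y hy ↦ ?_
  have h0 : f ((extChartAt I p).symm y) = 0 := by
    by_contra h
    exact hy.2 ⟨(extChartAt I p).symm y, subset_tsupport _ h, (extChartAt I p).right_inv hy.1⟩
  rw [h0, mul_zero, zero_mul]

/-- **Insertion of a second partition of unity** (Warner (1983), 4.8, eqs. (2)–(3);
Lee (2013), proof of Prop. 16.5). For a smooth partition of unity `ρ` subordinate to the sources
of the charts centred at `c i`, any second smooth partition of unity `ψ`, and finite sets `S`,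
`T` of indices off which `ρ i`, resp. `ψ j`, vanish identically (they exist on a compact
manifold), `α.integralPU ρ o c = ∑_{i ∈ S} ∑_{j ∈ T} ∫_{chart cᵢ} chartSign · (ρᵢ ψⱼ ∘ chart⁻¹) · α̂(e) dλ`:
pointwise `ρᵢ = ∑ⱼ ρᵢ ψⱼ`, and the sum leaves the integral because each term is integrable
(`integrableOn_chartIntegrand_of_tsupport_subset`). [cite: Warner1983, 4.8] -/
theorem integralPU_eq_sum_sum (ho : IsContinuousOrientation o) {α : MForm I M ℝ n}
    (hα : IsSmoothForm α) {ι κ : Type*} (ρ : SmoothPartitionOfUnity ι I M univ) (c : ι → M)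
    (hρ : ρ.IsSubordinate fun i ↦ (chartAt H (c i)).source)
    (ψ : SmoothPartitionOfUnity κ I M univ) {S : Finset ι} (hS : ∀ i ∉ S, ∀ x, ρ i x = 0)
    {T : Finset κ} (hT : ∀ j ∉ T, ∀ x, ψ j x = 0) :
    α.integralPU ρ o c = ∑ i ∈ S, ∑ j ∈ T, ∫ y in (extChartAt I (c i)).target,
      chartSign o (c i) y *
        (ρ i ((extChartAt I (c i)).symm y) * ψ j ((extChartAt I (c i)).symm y)) *
          α.inChart (c i) y (modelBasis E n) ∂(modelBasis E n).addHaar := by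
  have hρs : ∀ i, tsupport (ρ i) ⊆ (extChartAt I (c i)).source := fun i ↦ by
    rw [extChartAt_source]
    exact hρ i
  have hTsum : ∀ x, ∑ j ∈ T, ψ j x = 1 := fun x ↦ by
    have hsub : support (fun j ↦ ψ j x) ⊆ (T : Set κ) := fun j hj ↦ by
      simp only [Finset.mem_coe]
      by_contra h
      exact hj (hT j h x)
    exact (finsum_eq_sum_of_support_subset _ hsub).symm.trans (ψ.sum_eq_one (mem_univ x))
  -- each chart integral expands along `∑ⱼ ψⱼ = 1`
  have hexp : ∀ i, (∫ y in (extChartAt I (c i)).target, chartSign o (c i) y *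
      ρ i ((extChartAt I (c i)).symm y) * α.inChart (c i) y (modelBasis E n)
        ∂(modelBasis E n).addHaar) = ∑ j ∈ T, ∫ y in (extChartAt I (c i)).target,
      chartSign o (c i) y *
        (ρ i ((extChartAt I (c i)).symm y) * ψ j ((extChartAt I (c i)).symm y)) *
          α.inChart (c i) y (modelBasis E n) ∂(modelBasis E n).addHaar := by
    intro i
    have hint : ∀ j ∈ T, IntegrableOn (fun y ↦ chartSign o (c i) y *
        (ρ i ((extChartAt I (c i)).symm y) * ψ j ((extChartAt I (c i)).symm y)) *
          α.inChart (c i) y (modelBasis E n)) (extChartAt I (c i)).target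
            (modelBasis E n).addHaar := fun j _ ↦
      integrableOn_chartIntegrand_of_tsupport_subset ho hα (f := fun x ↦ ρ i x * ψ j x)
        ((map_continuous (ρ i)).mul (map_continuous (ψ j)))
        (tsupport_mul_subset_left.trans (hρs i))
    calc (∫ y in (extChartAt I (c i)).target, chartSign o (c i) y *
          ρ i ((extChartAt I (c i)).symm y) * α.inChart (c i) y (modelBasis E n)
            ∂(modelBasis E n).addHaar)
        = ∫ y in (extChartAt I (c i)).target, ∑ j ∈ T, chartSign o (c i) y *
            (ρ i ((extChartAt I (c i)).symm y) * ψ j ((extChartAt I (c i)).symm y)) *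
              α.inChart (c i) y (modelBasis E n) ∂(modelBasis E n).addHaar := by
          refine setIntegral_congr_fun (measurableSet_extChartAt_target (c i)) fun y _ ↦ ?_
          rw [← Finset.sum_mul, ← Finset.mul_sum, ← Finset.mul_sum, hTsum, mul_one]
      _ = ∑ j ∈ T, ∫ y in (extChartAt I (c i)).target, chartSign o (c i) y *
            (ρ i ((extChartAt I (c i)).symm y) * ψ j ((extChartAt I (c i)).symm y)) *
              α.inChart (c i) y (modelBasis E n) ∂(modelBasis E n).addHaar :=
          integral_finsetSum T hint
  -- only the indices in `S` contribute
  have hsupp : support (fun i ↦ ∫ y in (extChartAt I (c i)).target, chartSign o (c i) y *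
      ρ i ((extChartAt I (c i)).symm y) * α.inChart (c i) y (modelBasis E n)
        ∂(modelBasis E n).addHaar) ⊆ (S : Set ι) := by
    intro i hi
    simp only [Finset.mem_coe]
    by_contra h
    apply hi
    simp only [hS i h, mul_zero, zero_mul, integral_zero]
  have hdef : α.integralPU ρ o c = ∑ᶠ i, ∫ y in (extChartAt I (c i)).target,
      chartSign o (c i) y * ρ i ((extChartAt I (c i)).symm y) *
        α.inChart (c i) y (modelBasis E n) ∂(modelBasis E n).addHaar := rfl
  rw [hdef, finsum_eq_sum_of_support_subset _ hsupp]
  exact Finset.sum_congr rfl fun i _ ↦ hexp i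

/-! ### Independence of the partition of unity -/

variable [T2Space M] [SigmaCompactSpace M]

omit [CompactSpace M] in
variable (o) in
/-- **Independence of the partition of unity** (discharge of the named fact
`MForm.integralPU_eq_integral`): on a compact manifold with a continuous orientation family,
the integral of a smooth top form computed with any smooth partition of unity `ρ` subordinate to
the sources of the charts centred at `c i` equals `∫_M α`. Warner (1983), 4.8, eqs. (2)–(4):
insert the other partition of unity on each side (`integralPU_eq_sum_sum`), identify the
`(i, j)` terms chart by chart (`setIntegral_chartIntegrand_eq_of_support_subset`, the support
of `ρᵢ ψⱼ` lying in both chart sources), and exchange the two finite sums. Lee (2013),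
Prop. 16.5. [cite: Warner1983, 4.8] -/
theorem _root_.Literature.Geometry.Kaehler.MForm.integralPU_eq_integral_holds :
    MForm.integralPU_eq_integral o := by
  intro _ ι ρ c hρ ho α hα
  have hρs : ∀ i, tsupport (ρ i) ⊆ (extChartAt I (c i)).source := fun i ↦ by
    rw [extChartAt_source]
    exact hρ i
  have hψs : ∀ j, tsupport (chartPartitionOfUnity I M j) ⊆ (extChartAt I j).source := fun j ↦ by
    rw [extChartAt_source]
    exact chartPartitionOfUnity_isSubordinate j
  have hSf : {i | (support (ρ i)).Nonempty}.Finite := ρ.locallyFinite.finite_nonempty_of_compact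
  have hTf : {j | (support (chartPartitionOfUnity I M j)).Nonempty}.Finite :=
    (chartPartitionOfUnity I M).locallyFinite.finite_nonempty_of_compact
  have hS : ∀ i ∉ hSf.toFinset, ∀ x, ρ i x = 0 := fun i hi x ↦ by
    by_contra hx
    exact hi (hSf.mem_toFinset.2 ⟨x, hx⟩)
  have hT : ∀ j ∉ hTf.toFinset, ∀ x, chartPartitionOfUnity I M j x = 0 := fun j hj x ↦ by
    by_contra hx
    exact hj (hTf.mem_toFinset.2 ⟨x, hx⟩)
  -- the `(i, j)` terms agree chart by chart
  have hA : ∀ i j, (∫ y in (extChartAt I (c i)).target, chartSign o (c i) y *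
      (ρ i ((extChartAt I (c i)).symm y) * chartPartitionOfUnity I M j ((extChartAt I (c i)).symm y)) *
        α.inChart (c i) y (modelBasis E n) ∂(modelBasis E n).addHaar) =
      ∫ y in (extChartAt I j).target, chartSign o j y *
        (ρ i ((extChartAt I j).symm y) * chartPartitionOfUnity I M j ((extChartAt I j).symm y)) *
          α.inChart j y (modelBasis E n) ∂(modelBasis E n).addHaar := fun i j ↦
    setIntegral_chartIntegrand_eq_of_support_subset o α
      (f := fun x ↦ ρ i x * chartPartitionOfUnity I M j x) fun x hx ↦
        ⟨hρs i (subset_tsupport _ (left_ne_zero_of_mul hx)),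
          hψs j (subset_tsupport _ (right_ne_zero_of_mul hx))⟩
  calc α.integralPU ρ o c
      = ∑ i ∈ hSf.toFinset, ∑ j ∈ hTf.toFinset, ∫ y in (extChartAt I (c i)).target,
          chartSign o (c i) y * (ρ i ((extChartAt I (c i)).symm y) *
            chartPartitionOfUnity I M j ((extChartAt I (c i)).symm y)) *
              α.inChart (c i) y (modelBasis E n) ∂(modelBasis E n).addHaar :=
        integralPU_eq_sum_sum ho hα ρ c hρ (chartPartitionOfUnity I M) hS hT
    _ = ∑ i ∈ hSf.toFinset, ∑ j ∈ hTf.toFinset, ∫ y in (extChartAt I j).target,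
          chartSign o j y * (ρ i ((extChartAt I j).symm y) *
            chartPartitionOfUnity I M j ((extChartAt I j).symm y)) *
              α.inChart j y (modelBasis E n) ∂(modelBasis E n).addHaar :=
        Finset.sum_congr rfl fun i _ ↦ Finset.sum_congr rfl fun j _ ↦ hA i j
    _ = ∑ j ∈ hTf.toFinset, ∑ i ∈ hSf.toFinset, ∫ y in (extChartAt I j).target,
          chartSign o j y * (ρ i ((extChartAt I j).symm y) *
            chartPartitionOfUnity I M j ((extChartAt I j).symm y)) *
              α.inChart j y (modelBasis E n) ∂(modelBasis E n).addHaar :=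
        Finset.sum_comm
    _ = ∑ j ∈ hTf.toFinset, ∑ i ∈ hSf.toFinset, ∫ y in (extChartAt I j).target,
          chartSign o j y * (chartPartitionOfUnity I M j ((extChartAt I j).symm y) *
            ρ i ((extChartAt I j).symm y)) *
              α.inChart j y (modelBasis E n) ∂(modelBasis E n).addHaar :=
        Finset.sum_congr rfl fun j _ ↦ Finset.sum_congr rfl fun i _ ↦
          setIntegral_congr_fun (measurableSet_extChartAt_target j) fun y _ ↦ by ring
    _ = α.integral o :=
        (integralPU_eq_sum_sum ho hα (chartPartitionOfUnity I M) id
          chartPartitionOfUnity_isSubordinate ρ hT hS).symm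

end ChartChange

end Literature.NumberTheory.Transcendental
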